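import Summits.ABC.IUTFork.Joshi.ThetaJoshiDistinguished
import Summits.ABC.IUTFork.Joshi.FundamentalEstimateBLStandard
import HarnessLib

/-!
# Joshi, ATS III §6.10 → §7: the typed adelic locus `Θ̃^{B_{L′}}_Joshi` RE-KEYED into slot T-12's §7 signature (merge-debt T-11 ↔ T-12)

Record-only file of the abc-iut cell, block E (rung LADDER-ABC:A2.E), seat abc-iut-E-t11 (slot T-11; merge-debt row «T-11 ↔ T-12»
of `HOME/plan/E/ASSIGNMENTS.md` §3 and abc-iut-E-t12's INTERFACE NOTE 06:56:42Z (m1)/(m2)). Slot T-12's `Joshi/FundamentalEstimateBL.lean`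
(p428437) types [J-III] §7.1–7.4 over an INTERIM signature `ATS3.AdelicThetaDatum` whose fields `Idx`, `Xi`, `Xi_off`, `std`, `one`, `nrm`,
`nrm_one` abstract the §6 objects; this file INSTANTIATES that signature from the typed §6 objects of slot T-11 (`AdelicLiftDatum`,
`thetaLocusBL` = Def. 6.10.2, `distinguishedLift` = the element `Ξ^α_{0,z_Θ}` of the proof of Thm. 7.3.1, `trivialLift` = (6.5.1),
`lem652` = Lem. 6.5.2) plus the §3/§5/§7 data §6 does not carry (`BLData`: finiteness of `V^{odd,ss}`, `ℓ ≥ 5` prime, non-negativity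
and continuity of the norms for a chosen topology — (m2) —, `B⁺`, the standard point `z_Θ` of §4.4–4.5 with a family of Teichmüller
lifts, and the numbers `|q_w|_{ℂ_{p_w}}`). Per (m1) the norm is read at the clamped parameter (`ρ ↦ ρ` on `(0,1]`, else `1`), since
T-10's `ThetaLiftDatum.norm_teich` is recorded for `ρ ∈ (0,1]` only. CONSEQUENCES (kernel glue, derived): the re-keyed `locus` IS
`Θ̃^{B_{L′}}_Joshi` (`locus_toAdelicThetaDatum`); T-12's hypothesis `StandardPointNorms` on the re-keyed datum is EQUIVALENT to a
statement about residue-field absolute values only, `|ξ_{1;K_{y′_{w,j}}}|_{K_{y′_{w,j}}} = |q_w|^{(1/2ℓ)(j²/ℓ⋇²)}` at the `w`-components of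
`z_Θ` (`standardPointNorms_iff_absK`) — the input slot T-08's `StandardPointNormsSupply.lean` (p431046) discharges modulo its located
print input (STD) —, whence Thm. 7.3.1 AS TYPED holds for the ACTUAL locus of Def. 6.10.2 under that residue-field statement
(`fundamentalEstimateBL_of_absK`). Source: K. Joshi, arXiv:2401.13508 **v4** (unrefereed; bib `Joshi2024ATS3`), Def. 6.10.2 p.52
l.56–70, proof of Thm. 7.3.1 p.55 l.36 – p.56 l.110. TAKES NO SIDE on [IUTchIII] Cor. 3.12, on Joshi's claims or on Mochizuki's
report; typed ≠ proved; object-side file (R14): nothing of OUR `Cor312*`/`Thm311*` interface is imported.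
-/

noncomputable section

open Set

namespace Summit.ABC.IUTFork.Joshi.ATS3

namespace AdelicLiftDatum

variable {A : CollationDatum} {OE B : A.V → Type} [∀ w, CommRing (OE w)] [∀ w, CommRing (B w)]
  [∀ w, Algebra (OE w) (B w)] (𝔇 : AdelicLiftDatum A OE B)

/-- **The extra data slot T-12's §7 signature reads and §6 does not carry** (each with its print home): `V^{odd,ss}` is FINITE
(§3.4 p.28 l.31–33; p.55 l.31–35 «the product in the assertion is finite») and equals the collation datum's `Voddss`; «`ℓ ≥ 5` …
prime» (§3.3 (11)); the norms `|·|_{B_E,ρ}` are non-negative and, for a chosen topology on `B_E` (E-t12 (m2): the Fréchet topology,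
§7.4 p.56 l.117–121), continuous for `0 < ρ < 1`; `B⁺_E` with `|x|_1 ≤ 1` on it ([J-IIp] Prop. 9.4.1); the STANDARD POINT `z_Θ ∈ Σ̃_{L′}`
(§4.4–4.5, slot T-08) with a family `α` of Teichmüller lifts of the theta values at its bad-place components (proof of Thm. 7.3.1,
p.55 l.43–58); the absolute values `|q_w|_{ℂ_{p_w}} ∈ (0,1)` of the Tate parameters at `w ∈ V^{odd,ss}` (Thm. 7.3.1, p.55 l.3–9). DATA and
the cited elementary facts only; nothing of Joshi's is asserted. [claim: Joshi2024ATS3, status: disputed] -/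
structure BLData (𝔇 : AdelicLiftDatum A OE B) : Type 1 where
  /-- `V^{odd,ss}` as a finite set -/
  Vss : Finset A.V
  /-- … equal to the collation datum's `V^{odd,ss}` -/
  coe_Vss : (Vss : Set A.V) = A.Voddss
  /-- `ℓ ≥ 5`, i.e. `ℓ⋇ ≥ 2` (§3.3 (11)) -/
  two_le_lstar : 2 ≤ A.lstar
  /-- `ℓ = 2ℓ⋇ + 1` is prime (§3.3 (11)) -/
  prime_ell : (2 * A.lstar + 1).Prime
  /-- norms are non-negative ([FF18] Déf. 1.10.2) -/
  norm_nonneg : ∀ (w : A.V) (ρ : ℝ) (x : B w), 0 ≤ (𝔇.lift w).norm ρ x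
  /-- the (Fréchet) topology of `B_{E′_w}` (E-t12 (m2)) -/
  top : ∀ w : A.V, TopologicalSpace (B w)
  /-- each `|·|_ρ`, `0 < ρ < 1`, is continuous ([FF18] §1.6) -/
  continuous_norm : ∀ (w : A.V), ∀ ρ ∈ Set.Ioo (0 : ℝ) 1, @Continuous (B w) ℝ (top w) inferInstance ((𝔇.lift w).norm ρ)
  /-- `B⁺_{E′_w} ⊂ B_{E′_w}` (§5.2.2) -/
  Bplus : ∀ w : A.V, Set (B w)
  /-- `B⁺ = {x : |x|_1 ≤ 1}`, the half [J-IIp] Prop. 9.4.1 uses -/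
  norm_le_one_of_mem_Bplus : ∀ (w : A.V) (x : B w), x ∈ Bplus w → (𝔇.lift w).norm 1 x ≤ 1
  /-- the standard point `z_Θ` (§4.5 p.36 l.11–17; slot T-08) -/
  zTheta : Fin A.lstar → A.Arith
  /-- `z_Θ ∈ Σ̃_{L′}` (§4.5) -/
  zTheta_mem : zTheta ∈ A.adelicAnsatz
  /-- the Teichmüller lifts `α_{w,j}` at the components of `z_Θ` (p.55 l.43–58) -/
  α : ∀ w : A.V, Fin A.lstar → (𝔇.lift w).Cflat
  /-- `[α_{w,j}]` lifts `ξ_{1;K_{y′_{w,j}}}` at every `w ∈ V^{odd,ss}` -/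
  α_lift : ∀ w ∈ A.Voddss, ∀ j : Fin A.lstar, (𝔇.lift w).IsTeichLift (A.wComponent zTheta w j) (α w j)
  /-- `w ↦ |q_w|_{ℂ_{p_w}}` (read on `V^{odd,ss}` only) -/
  qAbs : A.V → ℝ
  /-- `0 < |q_w|` -/
  qAbs_pos : ∀ w ∈ A.Voddss, 0 < qAbs w
  /-- `|q_w| < 1` -/
  qAbs_lt_one : ∀ w ∈ A.Voddss, qAbs w < 1

open scoped Classical in
/-- The clamp of E-t12's (m1): `ρ ↦ ρ` on `(0,1]`, `ρ ↦ 1` otherwise (T-10's norm facts are recorded for `ρ ∈ (0,1]` only; §7 reads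
only such `ρ`). [folklore] -/
def clamp (_𝔇 : AdelicLiftDatum A OE B) (ρ : ℝ) : ℝ := if 0 < ρ ∧ ρ ≤ 1 then ρ else 1

/-- The clamp is the identity on `(0,1]`. [folklore] -/
theorem clamp_of_mem {ρ : ℝ} (hρ : ρ ∈ Set.Ioc (0 : ℝ) 1) : 𝔇.clamp ρ = ρ := by
  unfold clamp; rw [if_pos ⟨hρ.1, hρ.2⟩]

/-- The clamped parameter always lies in `(0,1]`. [folklore] -/
theorem clamp_mem (ρ : ℝ) : 𝔇.clamp ρ ∈ Set.Ioc (0 : ℝ) 1 := by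
  unfold clamp
  split_ifs with h
  · exact ⟨h.1, h.2⟩
  · exact ⟨one_pos, le_rfl⟩

variable {𝔇}

/-- Membership in the finite `V^{odd,ss}` is membership in `Voddss`. [folklore] -/
theorem BLData.mem_Vss_iff (X : 𝔇.BLData) (w : A.V) : w ∈ X.Vss ↔ w ∈ A.Voddss := by
  rw [← Finset.mem_coe, X.coe_Vss]

variable (𝔇)

/-- **THE RE-KEYING (merge-debt T-11 ↔ T-12)**: slot T-12's §7 signature `ATS3.AdelicThetaDatum` INSTANTIATED from the typed §6 objects —
`W := V_{L′}`, `B := B_{E′_w}`, `one := 1 = [1]` ((6.5.1), `trivialLift_eq_one`), `nrm w ρ := |·|_{B_{E′_w}, clamp ρ}` ((m1)), `Idx := Θ̃^{B_{L′}}_Joshi` itself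
(the subtype of `thetaLocusBL`, Def. 6.10.2) with `Xi` the inclusion, `Xi_off := apply_eq_trivialLift_of_mem` ((6.5.1) on the locus),
`std := Ξ^α_{0,z_Θ}` (`distinguishedLift`, in the locus by `distinguishedLift_mem`), and the `BLData` fields for the rest.
[claim: Joshi2024ATS3, status: disputed] -/
def toAdelicThetaDatum (X : 𝔇.BLData) : ATS3.AdelicThetaDatum where
  W := A.V
  Vss := X.Vss
  lstar := A.lstar
  two_le_lstar := X.two_le_lstar
  prime_ell := X.prime_ell
  B := B
  one _ := 1
  nrm w ρ x := (𝔇.lift w).norm (𝔇.clamp ρ) x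
  nrm_nonneg w ρ x := X.norm_nonneg w _ x
  nrm_one w ρ := by
    have h := 𝔇.lem652 w (𝔇.clamp_mem ρ).1 (𝔇.clamp_mem ρ).2
    rwa [𝔇.teich_oneFlat] at h
  top := X.top
  continuous_nrm w ρ hρ := by
    have hc : 𝔇.clamp ρ = ρ := 𝔇.clamp_of_mem ⟨hρ.1, hρ.2.le⟩
    simp only [hc]
    exact X.continuous_norm w ρ hρ
  Bplus := X.Bplus
  nrm_le_one_of_mem_Bplus w x hx := by
    have hc : 𝔇.clamp 1 = 1 := 𝔇.clamp_of_mem ⟨one_pos, le_rfl⟩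
    simp only [hc]
    exact X.norm_le_one_of_mem_Bplus w x hx
  Idx := {Ξ : 𝔇.Tuple // Ξ ∈ 𝔇.thetaLocusBL}
  Xi i := i.1
  Xi_off i w hw := by
    rw [X.mem_Vss_iff] at hw
    rw [𝔇.apply_eq_trivialLift_of_mem i.2 hw, 𝔇.trivialLift_eq_one]
    rfl
  std := ⟨𝔇.distinguishedLift X.zTheta X.α, 𝔇.distinguishedLift_mem X.zTheta_mem X.α_lift⟩
  qAbs := X.qAbs
  qAbs_pos w hw := X.qAbs_pos w ((X.mem_Vss_iff w).1 hw)
  qAbs_lt_one w hw := X.qAbs_lt_one w ((X.mem_Vss_iff w).1 hw)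

/-- The re-keyed locus of §7 IS the adelic theta-values locus `Θ̃^{B_{L′}}_Joshi` of Def. 6.10.2 (no longer an abstract range).
[folklore] -/
theorem locus_toAdelicThetaDatum (X : 𝔇.BLData) : (𝔇.toAdelicThetaDatum X).locus = 𝔇.thetaLocusBL := by
  show Set.range (fun i : {Ξ : 𝔇.Tuple // Ξ ∈ 𝔇.thetaLocusBL} => (i.1 : 𝔇.Tuple)) = 𝔇.thetaLocusBL
  exact Subtype.range_coe

/-- The re-keyed distinguished element is `Ξ^α_{0,z_Θ}`. [folklore] -/
theorem Xi_std_toAdelicThetaDatum (X : 𝔇.BLData) :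
    (𝔇.toAdelicThetaDatum X).Xi (𝔇.toAdelicThetaDatum X).std = 𝔇.distinguishedLift X.zTheta X.α := rfl

/-- The re-keyed norm at `ρ ∈ (0,1]` is `|·|_{B_{E′_w},ρ}` (the clamp is invisible where §7 reads it). [folklore] -/
theorem nrm_toAdelicThetaDatum (X : 𝔇.BLData) (w : A.V) {ρ : ℝ} (hρ : ρ ∈ Set.Ioc (0 : ℝ) 1) (x : B w) :
    (𝔇.toAdelicThetaDatum X).nrm w ρ x = (𝔇.lift w).norm ρ x := by
  show (𝔇.lift w).norm (𝔇.clamp ρ) x = _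
  rw [𝔇.clamp_of_mem hρ]

/-- **T-12's hypothesis `StandardPointNorms`, on the re-keyed datum, is a statement about RESIDUE-FIELD absolute values only**: it
holds iff `|ξ_{1;K_{y′_{w,j}}}|_{K_{y′_{w,j}}} = |q_w|^{(1/2ℓ)·(j²/ℓ⋇²)}` at the `w`-components `y′_{w,j}` of `z_Θ` for every `w ∈ V^{odd,ss}` — the norm
of the lift is `ρ`-independent and equals `|ξ_1|` by `norm_distinguishedLift` ([J-IIp] Prop. 7.4.2 as used p.56 l.29–45). The right
side is what slot T-08's supply chain (p431046) derives from valuation scaling modulo its located input (STD). [folklore] -/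
theorem standardPointNorms_iff_absK (X : 𝔇.BLData) :
    (𝔇.toAdelicThetaDatum X).StandardPointNorms ↔
      ∀ w ∈ A.Voddss, ∀ j : Fin A.lstar,
        (𝔇.lift w).absK (A.wComponent X.zTheta w j) ((𝔇.lift w).xi (A.wComponent X.zTheta w j)) =
          X.qAbs w ^ (𝔇.toAdelicThetaDatum X).stdExponent j := by
  constructor
  · intro h w hw j
    have h1 := h w ((X.mem_Vss_iff w).2 hw) 1 ⟨one_pos, le_rfl⟩ j
    rw [Xi_std_toAdelicThetaDatum, nrm_toAdelicThetaDatum 𝔇 X w ⟨one_pos, le_rfl⟩,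
      𝔇.norm_distinguishedLift X.α_lift w one_pos le_rfl j, if_pos hw] at h1
    exact h1
  · intro h w hw ρ hρ j
    change A.V at w
    change Fin A.lstar at j
    have hw' : w ∈ A.Voddss := (X.mem_Vss_iff w).1 hw
    rw [Xi_std_toAdelicThetaDatum, nrm_toAdelicThetaDatum 𝔇 X w hρ, 𝔇.norm_distinguishedLift X.α_lift w hρ.1 hρ.2 j,
      if_pos hw']
    exact h w hw' j

/-- **Thm. 7.3.1 AS TYPED, for the ACTUAL locus `Θ̃^{B_{L′}}_Joshi` of Def. 6.10.2**: granted the residue-field values at the standard point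
(the right side of `standardPointNorms_iff_absK`), `FundamentalEstimateBL` holds for the re-keyed datum — composition with T-12's
`fundamentalEstimateBL_of_standardPointNorms` (every `ℓ ≥ 5`). A conditional kernel statement about a typed candidate; nothing is
asserted about its inputs. [folklore] -/
theorem fundamentalEstimateBL_of_absK (X : 𝔇.BLData)
    (h : ∀ w ∈ A.Voddss, ∀ j : Fin A.lstar,
      (𝔇.lift w).absK (A.wComponent X.zTheta w j) ((𝔇.lift w).xi (A.wComponent X.zTheta w j)) =
        X.qAbs w ^ (𝔇.toAdelicThetaDatum X).stdExponent j) :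
    (𝔇.toAdelicThetaDatum X).FundamentalEstimateBL :=
  (𝔇.toAdelicThetaDatum X).fundamentalEstimateBL_of_standardPointNorms ((𝔇.standardPointNorms_iff_absK X).2 h)

/-- Size bookkeeping transported: the `(B_{L′},ρ)`-size (Def. 7.2.1) of an element of `Θ̃^{B_{L′}}_Joshi` is the finite product of its local
sizes over `V^{odd,ss}` (Lem. 7.2.4 / Rmk. 7.2.5 on the re-keyed datum, T-12's `adelicSize_Xi_eq_prod`). [folklore] -/
theorem adelicSize_eq_prod_of_mem (X : 𝔇.BLData) {Ξ : 𝔇.Tuple} (hΞ : Ξ ∈ 𝔇.thetaLocusBL) (ρ : ℝ) :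
    (𝔇.toAdelicThetaDatum X).adelicSize ρ Ξ =
      ∏ w ∈ X.Vss, (𝔇.toAdelicThetaDatum X).localSize w ρ (Ξ w) :=
  (𝔇.toAdelicThetaDatum X).adelicSize_Xi_eq_prod ρ ⟨Ξ, hΞ⟩

end AdelicLiftDatum

end Summit.ABC.IUTFork.Joshi.ATS3

end
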